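import Summits.QuantumAdvantage.QuantumAdvantage.Theorems.LinnikCubicClassGroupsDegreeOnePrimesEscapeConjClassCountRelative
import Summits.QuantumAdvantage.QuantumAdvantage.Theorems.LinnikCubicClassGroupsDegreeOnePrimesEscapeConjClassTheta
import HarnessLib

/-!
# From the Frobenius-weighted `ψ` of `E = N^H` to the primes of the BASE FIELD `F` with Frobenius class `C(σ)`

Topic `Summits/QuantumAdvantage/QuantumAdvantage/Theorems`, cell B2b-1 (linnik-cubic), PART A (gen 16); helper
toward the crux `DegreeOnePrimesEscape` (stmt-QuantumAdvantage-11543) — the prime bookkeeping of Deuring's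
reduction over an ARBITRARY base field `F` (`…ConjClassTheta.lean`, gen 13, is the case `F = ℚ`).
HONEST FRAMING: the value of this file is a THEOREM (kernel-checked) — NOT summit progress.

Let `N/F` be Galois with group `G`, `E` an intermediate field with `Gal(N/E)` abelian of order `m`, `σ ∈ Gal(N/E)`,
`ψ_σ(x) = Σ_{N𝔓^k ≤ x, 𝔓 unramified in N, Frob_𝔓^k = σ} log N𝔓` the Frobenius-weighted Chebyshev function of `E`
(the weight `w_σ` of `frobeniusPsi_dichotomy_signed_all`), and
`S_C(x) = Σ_{𝔮 ⊂ 𝓞_F, N𝔮 = p ≤ x prime, p ∤ d_N, Frob_𝔮 ∈ C(σ)} log N𝔮` — the degree-one primes of `F` whose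
Frobenius class in `Gal(N/F)` is `C(σ)` (some prime `𝔔 ∣ 𝔮` of `N` with trivial inertia has an arithmetic
Frobenius over `𝓞_F` conjugate to `σ`).

* `psiWeighted_degOne_sandwich'` — the sandwich of `…ConjClassTheta.lean` for an abstract pair `E`, `N`;
* `card_aut_mul_sum_weight_eq_rel` — Deuring at one prime `𝔮` of `F`:
  `m · Σ_{𝔓 ∣ 𝔮, N𝔓 = p} w_σ(𝔓) = |C_G(σ)| · 𝟙[Frob_𝔮 ∈ C(σ)]` (`card_aut_mul_card_degOneFrobPrimes_eq_relative`);
* `card_aut_mul_degOneSum_eq_rel` — summed: `m · A_{w_σ}(x) = |C_G(σ)| · S_C(x)`;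
* `abs_card_mul_psiFrob_sub_le_rel` —
  `|m ψ_σ(x) − |C_G(σ)| S_C(x)| ≤ m((ψ_E − θ_E)(x) + [E:ℚ](√x + 1) log x + [E:ℚ] ω(d_N) log|d_N|)`.

References: [LagariasMontgomeryOdlyzko1979, §3 (reduction to `L/L^{⟨σ⟩}` over the base `K`), §9].
-/

noncomputable section

open Finset Real NumberField IsDedekindDomain Ideal MulAction
open scoped NumberField nonZeroDivisors Classical Pointwise

namespace Summit.QuantumAdvantage.QuantumAdvantage.Theorems.DegreeOnePrimesEscape

open Literature.NumberTheory.LFunctions Literature.NumberTheory.LFunctions.NumberField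
  Literature.NumberTheory.NumberFields Literature.NumberTheory.GaloisRepresentations

section Sandwich

variable {E N : Type} [Field E] [NumberField E] [Field N] [NumberField N]

/-- **Sandwich** (`psiWeighted_degOne_sandwich` for an abstract pair of number fields `E`, `N`): for a weight
`0 ≤ w ≤ 1` on the ideals of `E` and `x ≥ 0`, writing `A_w(x) = Σ_{N𝔭 ≤ x, N𝔭 = p prime, p ∤ d_N} w(𝔭) log N𝔭`,
`0 ≤ ψ_w(x) − A_w(x) ≤ (ψ_E − θ_E)(x) + Σ_{N𝔭 ≤ x not prime} log N𝔭 + Σ_{N𝔭 = p ∣ d_N, N𝔭 ≤ x} log N𝔭`. -/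
theorem psiWeighted_degOne_sandwich' {w : Ideal (𝓞 E) → ℝ}
    (hw0 : ∀ I, 0 ≤ w I) (hw1 : ∀ I, w I ≤ 1) {x : ℝ} (hx : 0 ≤ x) :
    0 ≤ (∑ n ∈ Icc 0 ⌊x⌋₊, ∑ I ∈ idealsOfNorm E n, w I * idealVonMangoldt I) -
        ∑ P ∈ (finite_primeIdealsLE E x).toFinset with
          ((Ideal.absNorm P).Prime ∧ ¬ ((Ideal.absNorm P : ℤ) ∣ NumberField.discr N)), w P * Real.log (Ideal.absNorm P : ℝ) ∧
    (∑ n ∈ Icc 0 ⌊x⌋₊, ∑ I ∈ idealsOfNorm E n, w I * idealVonMangoldt I) -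
        ∑ P ∈ (finite_primeIdealsLE E x).toFinset with
          ((Ideal.absNorm P).Prime ∧ ¬ ((Ideal.absNorm P : ℤ) ∣ NumberField.discr N)), w P * Real.log (Ideal.absNorm P : ℝ) ≤
      (chebyshevPsiIdeal E x - chebyshevThetaIdeal E x) +
      ∑ P ∈ (finite_primeIdealsLE E x).toFinset with ¬ (Ideal.absNorm P).Prime, Real.log (Ideal.absNorm P : ℝ) +
      ∑ P ∈ (finite_primeIdealsLE E x).toFinset with ((Ideal.absNorm P).Prime ∧ ((Ideal.absNorm P : ℤ) ∣ NumberField.discr N)),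
        Real.log (Ideal.absNorm P : ℝ) := by
  classical
  rw [chebyshevPsiIdeal_eq_sum_vonMangoldtNorm, chebyshevThetaIdeal_eq_sum_primeIdealsLE E hx]
  set S := (finite_primeIdealsLE E x).toFinset with hS
  set U := (Icc 0 ⌊x⌋₊).biUnion (idealsOfNorm E) with hU
  have hdisj : Set.PairwiseDisjoint (↑(Icc 0 ⌊x⌋₊) : Set ℕ) (idealsOfNorm E) := by
    intro m _ n _ hmn
    rw [Function.onFun, Finset.disjoint_left]
    intro I hIm hIn
    rw [mem_idealsOfNorm] at hIm hIn
    exact hmn (hIm.symm.trans hIn)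
  have hsub : S ⊆ U := by
    intro P hP
    rw [hS, Set.Finite.mem_toFinset] at hP
    obtain ⟨-, -, hle⟩ := hP
    rw [hU, Finset.mem_biUnion]
    exact ⟨Ideal.absNorm P, mem_Icc.mpr ⟨Nat.zero_le _, Nat.le_floor hle⟩, by rw [mem_idealsOfNorm]⟩
  have hΛS : ∀ P ∈ S, idealVonMangoldt P = Real.log (Ideal.absNorm P : ℝ) := by
    intro P hP
    rw [hS, Set.Finite.mem_toFinset] at hP
    obtain ⟨hprime, hP0, -⟩ := hP
    have := idealVonMangoldt_prime_pow (Ideal.prime_of_isPrime hP0 hprime) one_ne_zero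
    rwa [pow_one] at this
  unfold vonMangoldtNorm
  rw [← Finset.sum_biUnion hdisj, ← Finset.sum_biUnion hdisj]
  have hθ : ∑ P ∈ S, Real.log (Ideal.absNorm P : ℝ) = ∑ I ∈ U, if I ∈ S then idealVonMangoldt I else 0 := by
    rw [← Finset.sum_filter, Finset.filter_mem_eq_inter, Finset.inter_eq_right.mpr hsub]
    exact Finset.sum_congr rfl fun P hP ↦ (hΛS P hP).symm
  have hA : ∑ P ∈ S with ((Ideal.absNorm P).Prime ∧ ¬ ((Ideal.absNorm P : ℤ) ∣ NumberField.discr N)),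
      w P * Real.log (Ideal.absNorm P : ℝ) =
      ∑ I ∈ U, if (I ∈ S ∧ ((Ideal.absNorm I).Prime ∧ ¬ ((Ideal.absNorm I : ℤ) ∣ NumberField.discr N)))
        then w I * idealVonMangoldt I else 0 := by
    rw [← Finset.sum_filter]
    have : U.filter (fun I ↦ I ∈ S ∧ ((Ideal.absNorm I).Prime ∧ ¬ ((Ideal.absNorm I : ℤ) ∣ NumberField.discr N))) =
        S.filter (fun P ↦ (Ideal.absNorm P).Prime ∧ ¬ ((Ideal.absNorm P : ℤ) ∣ NumberField.discr N)) := by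
      ext I; simp only [Finset.mem_filter]
      exact ⟨fun h ↦ ⟨h.2.1, h.2.2⟩, fun h ↦ ⟨hsub h.1, h.1, h.2⟩⟩
    rw [this]
    exact Finset.sum_congr rfl fun P hP ↦ by rw [hΛS P (Finset.mem_filter.mp hP).1]
  have hB : ∑ P ∈ S with ¬ (Ideal.absNorm P).Prime, Real.log (Ideal.absNorm P : ℝ) =
      ∑ I ∈ U, if (I ∈ S ∧ ¬ (Ideal.absNorm I).Prime) then idealVonMangoldt I else 0 := by
    rw [← Finset.sum_filter]
    have : U.filter (fun I ↦ I ∈ S ∧ ¬ (Ideal.absNorm I).Prime) = S.filter (fun P ↦ ¬ (Ideal.absNorm P).Prime) := by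
      ext I; simp only [Finset.mem_filter]
      exact ⟨fun h ↦ ⟨h.2.1, h.2.2⟩, fun h ↦ ⟨hsub h.1, h.1, h.2⟩⟩
    rw [this]
    exact Finset.sum_congr rfl fun P hP ↦ (hΛS P (Finset.mem_filter.mp hP).1).symm
  have hC : ∑ P ∈ S with ((Ideal.absNorm P).Prime ∧ ((Ideal.absNorm P : ℤ) ∣ NumberField.discr N)),
      Real.log (Ideal.absNorm P : ℝ) =
      ∑ I ∈ U, if (I ∈ S ∧ ((Ideal.absNorm I).Prime ∧ ((Ideal.absNorm I : ℤ) ∣ NumberField.discr N)))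
        then idealVonMangoldt I else 0 := by
    rw [← Finset.sum_filter]
    have : U.filter (fun I ↦ I ∈ S ∧ ((Ideal.absNorm I).Prime ∧ ((Ideal.absNorm I : ℤ) ∣ NumberField.discr N))) =
        S.filter (fun P ↦ (Ideal.absNorm P).Prime ∧ ((Ideal.absNorm P : ℤ) ∣ NumberField.discr N)) := by
      ext I; simp only [Finset.mem_filter]
      exact ⟨fun h ↦ ⟨h.2.1, h.2.2⟩, fun h ↦ ⟨hsub h.1, h.1, h.2⟩⟩
    rw [this]
    exact Finset.sum_congr rfl fun P hP ↦ (hΛS P (Finset.mem_filter.mp hP).1).symm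
  rw [← hU, hA, hB, hC, hθ, ← Finset.sum_sub_distrib, ← Finset.sum_sub_distrib, ← Finset.sum_add_distrib,
    ← Finset.sum_add_distrib]
  constructor
  · refine Finset.sum_nonneg fun I _ ↦ ?_
    have hΛ := idealVonMangoldt_nonneg I
    have h0 := hw0 I
    split_ifs <;> nlinarith
  · refine Finset.sum_le_sum fun I _ ↦ ?_
    have hΛ := idealVonMangoldt_nonneg I
    have h0 := hw0 I
    have h1 := hw1 I
    have hwΛ : w I * idealVonMangoldt I ≤ idealVonMangoldt I := by nlinarith
    split_ifs <;> first | linarith | (exfalso; tauto)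

end Sandwich

/-! ### Primes of the base field -/

section Primes

variable {F N : Type} [Field F] [NumberField F] [Field N] [NumberField N] [Algebra F N] [IsGalois F N]

omit [IsGalois F N] in
/-- A degree-one prime `𝔮` of `F` (`N𝔮 = p` prime) with `p ∤ d_N` is unramified in `N`. -/
theorem isUnramifiedIn_of_absNorm_prime_not_dvd (q : HeightOneSpectrum (𝓞 F)) {p : ℕ} (hp : p.Prime)
    (hq : absNorm q.asIdeal = p) (hd : ¬ ((p : ℤ) ∣ NumberField.discr N)) :
    Algebra.IsUnramifiedIn (𝓞 N) q.asIdeal := by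
  by_contra hram
  have hpq : (p : 𝓞 F) ∈ q.asIdeal := by rw [← hq]; exact Ideal.absNorm_mem _
  exact hd (dvd_discr_of_not_isUnramifiedIn (N := N) q hp hpq hram)

/-- **Deuring's reduction at one prime of the base**: for the Frobenius weight `w_σ` of `E` (`σ ∈ Gal(N/E)`,
`Gal(N/E)` abelian), a prime `𝔮` of `F` with `N𝔮 = p ≤ x` prime and `p ∤ d_N`:
`|Gal(N/E)| · Σ_{𝔓 ∣ 𝔮, N𝔓 = p, N𝔓 ≤ x} w_σ(𝔓) = |C_G(σ)| · 𝟙[Frob_𝔮 ∈ C(σ)]`. -/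
theorem card_aut_mul_sum_weight_eq_rel (E : IntermediateField F N) (hcomm : ∀ a b : N ≃ₐ[E] N, Commute a b)
    {σ : N ≃ₐ[F] N} (hσ : σ ∈ E.fixingSubgroup) {w : Ideal (𝓞 E) → ℝ}
    (hw : ∀ I, w I = if (∃ v : HeightOneSpectrum (𝓞 E), Algebra.IsUnramifiedIn (𝓞 N) v.asIdeal ∧
      ∃ k : ℕ, I = v.asIdeal ^ k ∧ galFrob E N v ^ k = IntermediateField.fixingSubgroupEquiv E ⟨σ, hσ⟩) then 1 else 0)
    (q : HeightOneSpectrum (𝓞 F)) {p : ℕ} (hp : p.Prime) (hq : absNorm q.asIdeal = p)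
    (hd : ¬ ((p : ℤ) ∣ NumberField.discr N)) {x : ℝ} (hpx : (p : ℝ) ≤ x) :
    (Nat.card (N ≃ₐ[E] N) : ℝ) *
        ∑ P ∈ (finite_primeIdealsLE E x).toFinset with (P.under (𝓞 F) = q.asIdeal ∧ Ideal.absNorm P = p), w P =
      (Nat.card (Subgroup.centralizer ({σ} : Set (N ≃ₐ[F] N))) : ℝ) *
        (if ∃ (Q : Ideal (𝓞 N)) (_ : Q.IsMaximal) (_ : Q.LiesOver q.asIdeal) (φ g : N ≃ₐ[F] N),
            IsArithFrobAt (𝓞 F) φ Q ∧ Q.inertia (N ≃ₐ[F] N) = ⊥ ∧ g * φ * g⁻¹ = σ then 1 else 0) := by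
  classical
  set τ' : N ≃ₐ[E] N := IntermediateField.fixingSubgroupEquiv E ⟨σ, hσ⟩ with hτ'
  set S := (finite_primeIdealsLE E x).toFinset with hS
  haveI : q.asIdeal.IsMaximal := q.isMaximal
  have hunrq : Algebra.IsUnramifiedIn (𝓞 N) q.asIdeal := isUnramifiedIn_of_absNorm_prime_not_dvd q hp hq hd
  -- every prime of `E` containing `p` is unramified in `N`
  have hunr : ∀ v : HeightOneSpectrum (𝓞 E), (p : 𝓞 E) ∈ v.asIdeal → Algebra.IsUnramifiedIn (𝓞 N) v.asIdeal := by
    intro v hpv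
    by_contra hram
    exact hd (dvd_discr_of_not_isUnramifiedIn (N := N) v hp hpv hram)
  -- the weight at a prime `P` with `N P = p`: `𝟙[Frob P = τ']`
  have hwP : ∀ P ∈ S.filter (fun P ↦ P.under (𝓞 F) = q.asIdeal ∧ Ideal.absNorm P = p),
      w P = if (∃ v : HeightOneSpectrum (𝓞 E), v.asIdeal = P ∧ galFrob E N v = τ') then 1 else 0 := by
    intro P hP
    rw [Finset.mem_filter, hS, Set.Finite.mem_toFinset] at hP
    obtain ⟨⟨hprime, hP0, -⟩, -, hNP⟩ := hP
    set vP : HeightOneSpectrum (𝓞 E) := ⟨P, hprime, hP0⟩ with hvP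
    have hpP : (p : 𝓞 E) ∈ P := by rw [← hNP]; exact Ideal.absNorm_mem P
    rw [hw P]
    have hiff : (∃ v : HeightOneSpectrum (𝓞 E), Algebra.IsUnramifiedIn (𝓞 N) v.asIdeal ∧
        ∃ k : ℕ, P = v.asIdeal ^ k ∧ galFrob E N v ^ k = τ') ↔
        (∃ v : HeightOneSpectrum (𝓞 E), v.asIdeal = P ∧ galFrob E N v = τ') := by
      constructor
      · rintro ⟨v, -, k, hPk, hk⟩
        obtain ⟨hvv, hk1⟩ := heightOneSpectrum_pow_eq_pow (v := vP) (v' := v) (m := 1) (k := k) one_pos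
          (by rw [pow_one]; exact hPk)
        refine ⟨v, by rw [← hvv], ?_⟩
        rw [← hk1, pow_one] at hk
        exact hk
      · rintro ⟨v, hv, hfrob⟩
        refine ⟨v, hunr v (by rw [hv]; exact hpP), 1, by rw [pow_one, hv], by rw [pow_one, hfrob]⟩
    by_cases h : ∃ v : HeightOneSpectrum (𝓞 E), v.asIdeal = P ∧ galFrob E N v = τ'
    · rw [if_pos h, if_pos (hiff.mpr h)]
    · rw [if_neg h, if_neg (fun h' ↦ h (hiff.mp h'))]
  rw [Finset.sum_congr rfl hwP, Finset.sum_boole]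
  -- the count of the good primes above `𝔮`
  set T₁ := (S.filter (fun P ↦ P.under (𝓞 F) = q.asIdeal ∧ Ideal.absNorm P = p)).filter
      (fun P ↦ ∃ v : HeightOneSpectrum (𝓞 E), v.asIdeal = P ∧ galFrob E N v = τ') with hT₁
  have hmemT₁ : ∀ P : Ideal (𝓞 E), P ∈ T₁ ↔ ((P.IsPrime ∧ P ≠ ⊥ ∧ (Ideal.absNorm P : ℝ) ≤ x) ∧
      (P.under (𝓞 F) = q.asIdeal ∧ Ideal.absNorm P = p)) ∧
      ∃ v : HeightOneSpectrum (𝓞 E), v.asIdeal = P ∧ galFrob E N v = τ' := by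
    intro P
    rw [hT₁, Finset.mem_filter, Finset.mem_filter, hS, Set.Finite.mem_toFinset]
    rfl
  have hcount : T₁.card = Nat.card {v : HeightOneSpectrum (𝓞 E) // v.asIdeal.LiesOver q.asIdeal ∧
      Ideal.absNorm v.asIdeal = p ∧ galFrob E N v = τ'} := by
    rw [← Nat.card_eq_finsetCard]
    symm
    refine Nat.card_congr
      { toFun := fun v ↦ ⟨v.1.asIdeal, (hmemT₁ _).mpr ⟨⟨⟨v.1.isPrime, v.1.ne_bot, by rw [v.2.2.1]; exact hpx⟩,
          v.2.1.over.symm, v.2.2.1⟩, v.1, rfl, v.2.2.2⟩⟩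
        invFun := fun P ↦ ⟨⟨P.1, ((hmemT₁ P.1).mp P.2).1.1.1, ((hmemT₁ P.1).mp P.2).1.1.2.1⟩,
          ⟨⟨((hmemT₁ P.1).mp P.2).1.2.1.symm⟩, ((hmemT₁ P.1).mp P.2).1.2.2, by
            obtain ⟨v, hv, hfrob⟩ := ((hmemT₁ P.1).mp P.2).2
            have hvv : v = ⟨P.1, ((hmemT₁ P.1).mp P.2).1.1.1, ((hmemT₁ P.1).mp P.2).1.1.2.1⟩ :=
              HeightOneSpectrum.ext hv
            rw [← hvv]; exact hfrob⟩⟩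
        left_inv := fun v ↦ rfl
        right_inv := fun P ↦ rfl }
  rw [hcount]
  -- a prime of `N` above `𝔮` with its Frobenius (used in both cases)
  obtain ⟨Q₀, hQ₀max, hQ₀over⟩ := Ideal.exists_maximal_ideal_liesOver_of_isIntegral (S := 𝓞 N) q.asIdeal
  haveI := hQ₀max
  haveI := hQ₀over
  have hQ₀mem : Q₀ ∈ q.asIdeal.primesOver (𝓞 N) := ⟨hQ₀max.isPrime, hQ₀over⟩
  have hQ₀ne : Q₀ ≠ ⊥ := Ideal.ne_bot_of_mem_primesOver q.ne_bot hQ₀mem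
  obtain ⟨φ₀, hφ₀⟩ := exists_isArithFrobAt_ringOfIntegers (M := F) Q₀ hQ₀ne
  have hI₀ : Q₀.inertia (N ≃ₐ[F] N) = ⊥ := inertia_eq_bot_of_isUnramifiedIn hunrq hQ₀mem
  -- Deuring's count
  split_ifs with hcl
  · obtain ⟨Q, hQmax, hQover, φ, g, hφ, -, hg⟩ := hcl
    have hQmem : Q ∈ q.asIdeal.primesOver (𝓞 N) := ⟨hQmax.isPrime, hQover⟩
    have key := card_aut_mul_card_degOneFrobPrimes_eq_relative E hcomm hunrq hp hq hQmem hφ hσ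
    rw [natCard_conj_eq_card_centralizer hg] at key
    rw [mul_one]
    exact_mod_cast key
  · have key := card_aut_mul_card_degOneFrobPrimes_eq_relative E hcomm hunrq hp hq hQ₀mem hφ₀ hσ
    have h0 : Nat.card {g : N ≃ₐ[F] N // g * φ₀ * g⁻¹ = σ} = 0 :=
      natCard_conj_eq_zero_of_forall fun g hg ↦ hcl ⟨Q₀, hQ₀max, hQ₀over, φ₀, g, hφ₀, hI₀, hg⟩
    rw [h0, Nat.mul_eq_zero] at key
    rcases key with h | h
    · exact absurd h Nat.card_pos.ne'
    · rw [h, Nat.cast_zero, mul_zero, mul_zero]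

omit [IsGalois F N] in
/-- A prime `P` of `E ⊇ F` of prime norm `p` lies over a prime of `F` of norm `p`. -/
theorem absNorm_under_eq_of_absNorm_prime (E : IntermediateField F N) (v : HeightOneSpectrum (𝓞 E))
    {p : ℕ} (hp : p.Prime) (hv : absNorm v.asIdeal = p) :
    absNorm (v.asIdeal.under (𝓞 F)) = p := by
  have h := (inertiaDeg_eq_one_of_prime_absNorm (M := F) v (by rw [hv]; exact hp)).2
  rw [hv] at h
  exact h

/-- **Deuring's reduction, summed over the degree-one primes of the base**:
`|Gal(N/E)| · Σ_{N𝔓 = p ≤ x prime, p ∤ d_N} w_σ(𝔓) log N𝔓 = |C_G(σ)| · Σ_{𝔮 ⊂ 𝓞_F, N𝔮 = p ≤ x prime, p ∤ d_N, Frob_𝔮 ∈ C(σ)} log N𝔮`. -/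
theorem card_aut_mul_degOneSum_eq_rel (E : IntermediateField F N) (hcomm : ∀ a b : N ≃ₐ[E] N, Commute a b)
    {σ : N ≃ₐ[F] N} (hσ : σ ∈ E.fixingSubgroup) {w : Ideal (𝓞 E) → ℝ}
    (hw : ∀ I, w I = if (∃ v : HeightOneSpectrum (𝓞 E), Algebra.IsUnramifiedIn (𝓞 N) v.asIdeal ∧
      ∃ k : ℕ, I = v.asIdeal ^ k ∧ galFrob E N v ^ k = IntermediateField.fixingSubgroupEquiv E ⟨σ, hσ⟩) then 1 else 0)
    (x : ℝ) :
    (Nat.card (N ≃ₐ[E] N) : ℝ) *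
        ∑ P ∈ (finite_primeIdealsLE E x).toFinset with
          ((Ideal.absNorm P).Prime ∧ ¬ ((Ideal.absNorm P : ℤ) ∣ NumberField.discr N)), w P * Real.log (Ideal.absNorm P : ℝ) =
      (Nat.card (Subgroup.centralizer ({σ} : Set (N ≃ₐ[F] N))) : ℝ) *
        ∑ q ∈ (finite_primeIdealsLE F x).toFinset with
          ((Ideal.absNorm q).Prime ∧ ¬ ((Ideal.absNorm q : ℤ) ∣ NumberField.discr N) ∧
            ∃ (Q : Ideal (𝓞 N)) (_ : Q.IsMaximal) (_ : Q.LiesOver q) (φ g : N ≃ₐ[F] N),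
              IsArithFrobAt (𝓞 F) φ Q ∧ Q.inertia (N ≃ₐ[F] N) = ⊥ ∧ g * φ * g⁻¹ = σ),
          Real.log (Ideal.absNorm q : ℝ) := by
  classical
  set S := (finite_primeIdealsLE E x).toFinset with hS
  set T := S.filter (fun P ↦ (Ideal.absNorm P).Prime ∧ ¬ ((Ideal.absNorm P : ℤ) ∣ NumberField.discr N)) with hT
  set SF := (finite_primeIdealsLE F x).toFinset with hSF
  set R := SF.filter (fun q ↦ (Ideal.absNorm q).Prime ∧ ¬ ((Ideal.absNorm q : ℤ) ∣ NumberField.discr N)) with hR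
  set Pcl : Ideal (𝓞 F) → Prop := fun q ↦ ∃ (Q : Ideal (𝓞 N)) (_ : Q.IsMaximal) (_ : Q.LiesOver q)
    (φ g : N ≃ₐ[F] N), IsArithFrobAt (𝓞 F) φ Q ∧ Q.inertia (N ≃ₐ[F] N) = ⊥ ∧ g * φ * g⁻¹ = σ with hPcl
  -- `P ↦ P ∩ 𝓞_F` maps `T` into `R`
  have hmaps : ∀ P ∈ T, P.under (𝓞 F) ∈ R := by
    intro P hP
    rw [hT, Finset.mem_filter, hS, Set.Finite.mem_toFinset] at hP
    obtain ⟨⟨hPp, hP0, hle⟩, hprime, hnd⟩ := hP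
    set vP : HeightOneSpectrum (𝓞 E) := ⟨P, hPp, hP0⟩ with hvP
    have hNu : absNorm (P.under (𝓞 F)) = absNorm P :=
      absNorm_under_eq_of_absNorm_prime E vP hprime rfl
    haveI := hPp
    rw [hR, Finset.mem_filter, hSF, Set.Finite.mem_toFinset]
    refine ⟨⟨IsPrime.under (𝓞 F) P, ?_, by rw [hNu]; exact hle⟩, by rw [hNu]; exact hprime, by rw [hNu]; exact hnd⟩
    intro h0
    have : absNorm (P.under (𝓞 F)) = 0 := by rw [h0, Ideal.absNorm_bot]
    rw [hNu] at this
    exact hprime.ne_zero this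
  rw [← Finset.sum_fiberwise_of_maps_to hmaps, Finset.mul_sum]
  -- the right-hand side as a sum over `R`
  have hRHS : ∑ q ∈ SF.filter (fun q ↦ (Ideal.absNorm q).Prime ∧ ¬ ((Ideal.absNorm q : ℤ) ∣ NumberField.discr N) ∧ Pcl q),
      Real.log (Ideal.absNorm q : ℝ) = ∑ q ∈ R, (if Pcl q then 1 else 0) * Real.log (Ideal.absNorm q : ℝ) := by
    rw [hR, Finset.sum_filter, Finset.sum_filter]
    refine Finset.sum_congr rfl fun q _ ↦ ?_
    by_cases h1 : (Ideal.absNorm q).Prime ∧ ¬ ((Ideal.absNorm q : ℤ) ∣ NumberField.discr N)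
    · rw [if_pos h1]
      by_cases h2 : Pcl q
      · rw [if_pos ⟨h1.1, h1.2, h2⟩, if_pos h2, one_mul]
      · rw [if_neg (fun h ↦ h2 h.2.2), if_neg h2, zero_mul]
    · rw [if_neg (fun h ↦ h1 ⟨h.1, h.2.1⟩), if_neg h1]
  rw [hRHS, Finset.mul_sum]
  refine Finset.sum_congr rfl fun q hqR ↦ ?_
  rw [hR, Finset.mem_filter, hSF, Set.Finite.mem_toFinset] at hqR
  obtain ⟨⟨hqp, hq0, hqle⟩, hprime, hnd⟩ := hqR
  set p : ℕ := Ideal.absNorm q with hpdef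
  set vq : HeightOneSpectrum (𝓞 F) := ⟨q, hqp, hq0⟩ with hvq
  haveI : q.IsMaximal := vq.isMaximal
  -- the fibre `{P ∈ T : P ∩ 𝓞_F = 𝔮}` is `{P ∈ S : P ∣ 𝔮, N P = p}`, and on it `log N P = log p`
  have hfib : T.filter (fun P ↦ P.under (𝓞 F) = q) = S.filter (fun P ↦ P.under (𝓞 F) = q ∧ Ideal.absNorm P = p) := by
    rw [hT, Finset.filter_filter]
    refine Finset.filter_congr fun P hP ↦ ?_
    rw [hS, Set.Finite.mem_toFinset] at hP
    obtain ⟨hPp, hP0, -⟩ := hP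
    set vP : HeightOneSpectrum (𝓞 E) := ⟨P, hPp, hP0⟩ with hvP
    constructor
    · rintro ⟨⟨hPprime, -⟩, hu⟩
      have hNu : absNorm (P.under (𝓞 F)) = absNorm P := absNorm_under_eq_of_absNorm_prime E vP hPprime rfl
      rw [hu] at hNu
      exact ⟨hu, hNu.symm⟩
    · rintro ⟨hu, hNP⟩
      exact ⟨⟨by rw [hNP]; exact hprime, by rw [hNP]; exact hnd⟩, hu⟩
  have hsum : ∑ P ∈ T.filter (fun P ↦ P.under (𝓞 F) = q), w P * Real.log (Ideal.absNorm P : ℝ) =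
      (∑ P ∈ S.filter (fun P ↦ P.under (𝓞 F) = q ∧ Ideal.absNorm P = p), w P) * Real.log (p : ℝ) := by
    rw [hfib, Finset.sum_mul]
    refine Finset.sum_congr rfl fun P hP ↦ ?_
    rw [(Finset.mem_filter.mp hP).2.2]
  have hpx : (p : ℝ) ≤ x := hqle
  rw [hsum, ← mul_assoc, card_aut_mul_sum_weight_eq_rel E hcomm hσ hw vq hprime rfl hnd hpx, mul_assoc]

/-- **`|m ψ_σ(x) − |C_G(σ)| S_C(x)|` is small, over the base `F`**: for the Frobenius weight `w_σ` of `E`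
(`Gal(N/E)` abelian of order `m`, `σ ∈ Gal(N/E)`) and `x ≥ 1`,
`|m ψ_{w_σ}(x) − |C_G(σ)| Σ_{𝔮 ⊂ 𝓞_F, N𝔮 = p ≤ x prime, p ∤ d_N, Frob_𝔮 ∈ C(σ)} log N𝔮| ≤
 m((ψ_E − θ_E)(x) + [E:ℚ](√x + 1) log x + [E:ℚ] ω(d_N) log|d_N|)`. [cite: LagariasMontgomeryOdlyzko1979, §3] -/
theorem abs_card_mul_psiFrob_sub_le_rel (E : IntermediateField F N) (hcomm : ∀ a b : N ≃ₐ[E] N, Commute a b)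
    {σ : N ≃ₐ[F] N} (hσ : σ ∈ E.fixingSubgroup) {w : Ideal (𝓞 E) → ℝ}
    (hw : ∀ I, w I = if (∃ v : HeightOneSpectrum (𝓞 E), Algebra.IsUnramifiedIn (𝓞 N) v.asIdeal ∧
      ∃ k : ℕ, I = v.asIdeal ^ k ∧ galFrob E N v ^ k = IntermediateField.fixingSubgroupEquiv E ⟨σ, hσ⟩) then 1 else 0)
    {x : ℝ} (hx : 1 ≤ x) :
    |(Nat.card (N ≃ₐ[E] N) : ℝ) * (∑ n ∈ Icc 0 ⌊x⌋₊, ∑ I ∈ idealsOfNorm E n, w I * idealVonMangoldt I) -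
      (Nat.card (Subgroup.centralizer ({σ} : Set (N ≃ₐ[F] N))) : ℝ) *
        ∑ q ∈ (finite_primeIdealsLE F x).toFinset with
          ((Ideal.absNorm q).Prime ∧ ¬ ((Ideal.absNorm q : ℤ) ∣ NumberField.discr N) ∧
            ∃ (Q : Ideal (𝓞 N)) (_ : Q.IsMaximal) (_ : Q.LiesOver q) (φ g : N ≃ₐ[F] N),
              IsArithFrobAt (𝓞 F) φ Q ∧ Q.inertia (N ≃ₐ[F] N) = ⊥ ∧ g * φ * g⁻¹ = σ),
          Real.log (Ideal.absNorm q : ℝ)| ≤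
      (Nat.card (N ≃ₐ[E] N) : ℝ) * ((chebyshevPsiIdeal E x - chebyshevThetaIdeal E x) +
        Module.finrank ℚ E * (Real.sqrt x + 1) * Real.log x +
        Module.finrank ℚ E * ((NumberField.discr N).natAbs.primeFactors.card) *
          Real.log ((NumberField.discr N).natAbs : ℝ)) := by
  have hw0 : ∀ I, 0 ≤ w I := fun I ↦ by rw [hw I]; split_ifs <;> norm_num
  have hw1 : ∀ I, w I ≤ 1 := fun I ↦ by rw [hw I]; split_ifs <;> norm_num
  rw [← card_aut_mul_degOneSum_eq_rel E hcomm hσ hw x, ← mul_sub, abs_mul, abs_of_nonneg (Nat.cast_nonneg _)]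
  refine mul_le_mul_of_nonneg_left ?_ (Nat.cast_nonneg _)
  obtain ⟨hlo, hhi⟩ := psiWeighted_degOne_sandwich' (E := E) (N := N) hw0 hw1 (by linarith : (0 : ℝ) ≤ x)
  have h2 := sum_log_absNorm_not_prime_le (E := E) hx
  have h3 := sum_log_absNorm_prime_dvd_le (E := E) (N := N) x
  rw [abs_of_nonneg hlo]
  linarith

end Primes

end Summit.QuantumAdvantage.QuantumAdvantage.Theorems.DegreeOnePrimesEscape

end
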